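import Literature.MathematicalPhysics.QuantumFieldTheory.Chatterjee2019LargeN.AreaLowerBound
import HarnessLib

/-!
# Chatterjee 2019, §§2.1–2.2: backtrack erasure preserves closed paths, the nonbacktracking core is a loop, and the string operations map loops to loops

S. Chatterjee, *Rigorous solution of strongly coupled `SO(N)` lattice gauge theory in the large `N` limit*,
Comm. Math. Phys. **366** (2019) 203–268 (arXiv:1502.07719).  **§2.1**: «Given a path `ρ = e₁e₂⋯eₙ` that has a
backtrack at location `i`, the path obtained by erasing this backtrack is … It is easy to check that `ρ'` is indeed
a path, and it is closed if `ρ` is closed. If `ρ` is closed and has a backtrack at location `n`, then backtrack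
erasure at location `n` results in `ρ' := e₂e₃⋯eₙ₋₁`. Again, it is easy to check that `ρ'` is a closed path.» —
«If we start with a closed path `ρ` and keep erasing backtracks successively, we must at some point end up with a
closed path with no backtracks … Nonbacktracking cycles will be called loops», and the cyclic equivalence of
closed paths (`ρ' = eᵢ ⋯ eₙ e₁ ⋯ eᵢ₋₁`).  **§2.2**: the splittings `×¹_{x,y} l`, `×²_{x,y} l`, twistings
`∝_{x,y} l`, mergers `l ⊕_{x,y} l'`, `l ⊖_{x,y} l'` and deformations `l ⊕ₓ p`, `l ⊖ₓ p` of loops are (cores of closed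
paths, hence) loops, so that these operations — and the moves of a trajectory — send loop sequences to loop
sequences.  THEOREMS ONLY over the sibling modules (`LatticeStrings`: `core = FreeGroup.reduceCyclically ∘ reduce`,
flag F2 there; interior backtrack erasure = a `FreeGroup.Red.Step`, terminal erasure = the conjugator stripped by
`reduceCyclically`), plus one auxiliary definition `IsPathFromTo ρ A B` («a path from `A` to `B`», the endpoint
bookkeeping `u(e₁) = A`, `v(eₙ) = B` of §2.1) with its composition / reversal calculus.

Devices (ours, bookkeeping only): a word `ρ` is a closed path iff the doubled word `ρρ` is a path
(`isClosedPath_iff_isPath_append_self`), and is cyclically reduced iff `ρρ` is reduced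
(`isCyclicallyReduced_iff_isReduced_append_self`); both make erasure and rotation invariance one-liners.  The §2.2
results are endpoint compositions: for `l = e b e' c` read from location `x`, `b : v(e) → u(e')` and `c : v(e') → u(e)`
(`Word.arcs_isPathFromTo`).

Main results: `IsClosedPath.of_red` (backtrack erasures preserve closed paths), `IsClosedPath.core`,
`isLoop_core` («the nonbacktracking core is a loop»), `IsLoop.core_eq`, `IsClosedPath.rotate`, `IsLoop.rotate`;
`Word.isLoop_posSplit₁/₂`, `isLoop_negSplit₁/₂`, `isLoop_negTwist`, `isLoop_posTwist`, `isLoop_posMerge`,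
`isLoop_negMerge`, `isLoop_posDeform`, `isLoop_negDeform`; `IsLoopSeq.posSplitAt`, `negSplitAt`, `negTwistAt`,
`posTwistAt`, `posDeformAt`, `negDeformAt`, `posMergeAt`, `negMergeAt`, `IsLoopSeq.moveResult`.
(v1.1, last section) the NON-NULLNESS clauses of **Lemmas 9.3 / 9.5** — `Word.posSplit₁_ne_nil`, `posSplit₂_ne_nil`,
`negSplit₁_ne_nil`, `negSplit₂_ne_nil` (a nonempty piece of a loop is reduced, and a nonempty reduced word has a non-null
core, `Word.core_ne_nil`; in the inverse case the pieces are nonempty because `e e⁻¹` / `e⁻¹ … e` would be an interior /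
terminal backtrack) — and their consequence **Lemma 11.3** («`𝒳₀(s)` is empty»: `Trajectory.numDeform_pos`,
`isEmpty_trajectoryWith_zero`) with ★ `coeffA_zero_of_ne_nil` («`a₀(s) = 0` for every non-null `s`», §10; the first
conjunct of the named fact `CoeffRecursion`), all hypothesis-free.

## WHAT THIS IS NOT
Lemma 2.1 itself (uniqueness of the core up to cyclic equivalence: `core (ρ.rotate k)` is a rotation of `core ρ`)
is not proved here (the tree's `core` is a normal form, flag F2 of `LatticeStrings`); nor the exact length statements
`|×¹| + |×²| = |l|` of Lemmas 9.3–9.6 beyond what `MasterLoopEquation` already has.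
-/


noncomputable section

open Literature.Probability.LatticeModels Literature.MathematicalPhysics.QuantumLattice

namespace Literature.MathematicalPhysics.QuantumFieldTheory.Chatterjee2019LargeN

variable {d : ℕ}

/-! ### Doubling characterizations -/

/-- A word is a closed path iff the doubled word `ρρ` is a path (the closing condition `v(eₙ) = u(e₁)` is the
middle junction). [cite: Chatterjee2019LargeN, §2.1 (closed path: v(eₙ) = u(e₁))] -/
theorem isClosedPath_iff_isPath_append_self (ρ : Word d) : IsClosedPath ρ ↔ IsPath (ρ ++ ρ) := by
  rw [IsClosedPath, IsPath, IsPath, List.isChain_append]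
  constructor
  · rintro ⟨hp, hc⟩
    refine ⟨hp, hp, fun x hx y hy => ?_⟩
    have hne : ρ ≠ [] := by rintro rfl; simp at hx
    rw [List.getLast?_eq_some_getLast hne, Option.mem_def, Option.some.injEq] at hx
    rw [List.head?_eq_some_head hne, Option.mem_def, Option.some.injEq] at hy
    subst hx; subst hy
    exact hc hne
  · rintro ⟨hp, -, hc⟩
    refine ⟨hp, fun hne => hc _ ?_ _ ?_⟩
    · rw [List.getLast?_eq_some_getLast hne]; rfl
    · rw [List.head?_eq_some_head hne]; rfl

/-- A word is cyclically reduced (no interior and no terminal backtrack) iff the doubled word is reduced.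
[cite: Chatterjee2019LargeN, §2.1 (interior and terminal backtracks)] -/
theorem isCyclicallyReduced_iff_isReduced_append_self (ρ : Word d) :
    FreeGroup.IsCyclicallyReduced ρ ↔ FreeGroup.IsReduced (ρ ++ ρ) := by
  rw [FreeGroup.isCyclicallyReduced_iff, FreeGroup.IsReduced, FreeGroup.IsReduced, List.isChain_append]
  tauto

/-- Hence: `ρ` is a loop iff `ρρ` is a nonbacktracking path (reduced path). [cite: Chatterjee2019LargeN, §2.1 (loops)] -/
theorem isLoop_iff_append_self (ρ : Word d) :
    IsLoop ρ ↔ IsPath (ρ ++ ρ) ∧ FreeGroup.IsReduced (ρ ++ ρ) := by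
  rw [IsLoop, isClosedPath_iff_isPath_append_self, isCyclicallyReduced_iff_isReduced_append_self]

/-- A closed path's doubled word is a path. [cite: Chatterjee2019LargeN, §2.1] -/
theorem IsClosedPath.isPath_append_self {ρ : Word d} (h : IsClosedPath ρ) : IsPath (ρ ++ ρ) :=
  (isClosedPath_iff_isPath_append_self ρ).mp h

/-- … and so is the tripled word. [cite: Chatterjee2019LargeN, §2.1] -/
theorem IsClosedPath.isPath_append_append_self {ρ : Word d} (h : IsClosedPath ρ) : IsPath (ρ ++ ρ ++ ρ) := by
  have h2 := h.isPath_append_self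
  rw [List.append_assoc]
  rw [IsPath, List.isChain_append] at h2 ⊢
  obtain ⟨h1, -, hj⟩ := h2
  refine ⟨h1, h.isPath_append_self, fun x hx y hy => hj x hx y ?_⟩
  cases ρ with
  | nil => simp at hy
  | cons a t => simpa using hy

/-- Sub-words of paths are paths. [cite: Chatterjee2019LargeN, §2.1 (paths)] -/
theorem IsPath.infix {ρ ρ' : Word d} (h : IsPath ρ) (h' : ρ' <:+: ρ) : IsPath ρ' :=
  List.IsChain.infix h h'

/-! ### Backtrack erasure preserves (closed) paths -/

/-- «It is easy to check that `ρ'` is indeed a path»: erasing an interior backtrack `e e⁻¹` (a free-group reduction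
step) from a path gives a path, since `v(eᵢ₋₁) = u(e) = v(e⁻¹) = u(eᵢ₊₂)`. [cite: Chatterjee2019LargeN, §2.1 (backtrack erasure)] -/
theorem IsPath.of_step {ρ ρ' : Word d} (h : IsPath ρ) (hs : FreeGroup.Red.Step ρ ρ') : IsPath ρ' := by
  cases hs with
  | not =>
    rename_i L₁ L₂ x b
    rw [IsPath, List.isChain_append] at h ⊢
    obtain ⟨h1, h2, h3⟩ := h
    refine ⟨h1, h2.tail.tail, fun p hp q hq => ?_⟩
    have hpq : DEdge.tgt p = DEdge.src (x, b) := h3 p hp (x, b) (by simp)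
    have h2' := (List.isChain_cons.mp h2.tail).1 q hq
    rw [hpq, ← h2']
    exact (DEdge.tgt_inv (x, b)).symm

/-- Successive backtrack erasures preserve paths. [cite: Chatterjee2019LargeN, §2.1] -/
theorem IsPath.of_red {ρ ρ' : Word d} (h : IsPath ρ) (hr : FreeGroup.Red ρ ρ') : IsPath ρ' := by
  induction hr with
  | refl => exact h
  | tail _ hs ih => exact ih.of_step hs

/-- «and it is closed if `ρ` is closed»: successive (interior) backtrack erasures preserve closed paths.
[cite: Chatterjee2019LargeN, §2.1 (backtrack erasure of a closed path)] -/
theorem IsClosedPath.of_red {ρ ρ' : Word d} (h : IsClosedPath ρ) (hr : FreeGroup.Red ρ ρ') : IsClosedPath ρ' := by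
  rw [isClosedPath_iff_isPath_append_self] at h ⊢
  exact h.of_red (FreeGroup.Red.append_append hr hr)

/-- The free reduction (all interior backtracks erased) of a closed path is a closed path.
[cite: Chatterjee2019LargeN, §2.1] -/
theorem IsClosedPath.reduce {ρ : Word d} (h : IsClosedPath ρ) : IsClosedPath (FreeGroup.reduce ρ) :=
  h.of_red FreeGroup.reduce.red

/-- `ρ⁻¹ ρ` erases to the null path. [cite: Chatterjee2019LargeN, §2.1 (backtrack erasure)] -/
theorem red_invRev_append_self (c : Word d) : FreeGroup.Red (FreeGroup.invRev c ++ c) [] := by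
  have h := FreeGroup.reduce.red (L := FreeGroup.invRev c ++ c)
  rwa [FreeGroup.reduce_invRev_left_cancel] at h

/-- Terminal backtrack erasure: if `c r c⁻¹` is a closed path then so is `r` («backtrack erasure at location `n`
results in `ρ' := e₂e₃⋯eₙ₋₁`. Again, it is easy to check that `ρ'` is a closed path»; iterated over the conjugator
`c`). [cite: Chatterjee2019LargeN, §2.1 (terminal backtrack erasure)] -/
theorem IsClosedPath.of_conj {c r : Word d} (h : IsClosedPath (c ++ r ++ FreeGroup.invRev c)) : IsClosedPath r := by
  rw [isClosedPath_iff_isPath_append_self] at h ⊢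
  have h1 : IsPath ((c ++ r) ++ (FreeGroup.invRev c ++ c) ++ (r ++ FreeGroup.invRev c)) := by
    simpa only [List.append_assoc] using h
  have h2 : IsPath ((c ++ r) ++ [] ++ (r ++ FreeGroup.invRev c)) :=
    h1.of_red (FreeGroup.Red.append_append (FreeGroup.Red.append_append FreeGroup.Red.refl
      (red_invRev_append_self c)) FreeGroup.Red.refl)
  exact h2.infix ⟨c, FreeGroup.invRev c, by simp⟩

/-- **The nonbacktracking core of a closed path is a closed path.** [cite: Chatterjee2019LargeN, §2.1 (nonbacktracking core [l])] -/
theorem IsClosedPath.core {ρ : Word d} (h : IsClosedPath ρ) : IsClosedPath (core ρ) := by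
  have h1 := h.reduce
  rw [← FreeGroup.reduceCyclically.conj_conjugator_reduceCyclically (FreeGroup.reduce ρ)] at h1
  exact IsClosedPath.of_conj h1

/-- **The nonbacktracking core `[ρ]` of a closed path is a loop** («we must at some point end up with a closed
path with no backtracks … Nonbacktracking cycles will be called loops»). [cite: Chatterjee2019LargeN, §2.1 (nonbacktracking core, loops)] -/
theorem isLoop_core {ρ : Word d} (h : IsClosedPath ρ) : IsLoop (core ρ) :=
  ⟨h.core, isCyclicallyReduced_core ρ⟩

/-- The core of a loop is the loop itself (no backtrack to erase). [cite: Chatterjee2019LargeN, §2.1 ([l] = l for a loop)] -/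
theorem IsLoop.core_eq {ρ : Word d} (h : IsLoop ρ) : core ρ = ρ := by
  rw [core, h.2.isReduced.reduce_eq]
  obtain ⟨-, hc⟩ := h.2
  induction ρ using List.bidirectionalRec with
  | nil => simp
  | singleton a => simp
  | cons_append a L b _ =>
    have hba := hc b (by rw [← List.cons_append, List.getLast?_concat]; rfl) a (by simp)
    rw [FreeGroup.reduceCyclically.cons_append, if_neg]
    · simp
    · rintro ⟨h1, h2⟩
      rw [← hba h1] at h2
      revert h2
      cases b.2 <;> decide

/-! ### Cyclic equivalence: rotations of closed paths and loops -/

/-- The doubled rotation is a sub-word of the tripled word. [folklore] -/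
private theorem rotate_append_rotate_infix (ρ : Word d) (k : ℕ) :
    ρ.rotate k ++ ρ.rotate k <:+: ρ ++ ρ ++ ρ := by
  rw [List.rotate_eq_drop_append_take_mod]
  refine ⟨ρ.take (k % ρ.length), ρ.drop (k % ρ.length), ?_⟩
  have h := List.take_append_drop (k % ρ.length) ρ
  conv_rhs => rw [← h]
  simp only [List.append_assoc]

/-- **Cyclically equivalent closed paths**: every rotation `eᵢ ⋯ eₙ e₁ ⋯ eᵢ₋₁` of a closed path is a closed path.
[cite: Chatterjee2019LargeN, §2.1 (cyclic equivalence of closed paths, cycles)] -/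
theorem IsClosedPath.rotate {ρ : Word d} (h : IsClosedPath ρ) (k : ℕ) : IsClosedPath (ρ.rotate k) := by
  rw [isClosedPath_iff_isPath_append_self]
  exact h.isPath_append_append_self.infix (rotate_append_rotate_infix ρ k)

/-- Every rotation of a cyclically reduced word is cyclically reduced («each member of such an equivalence class is
nonbacktracking»). [cite: Chatterjee2019LargeN, §2.1 (nonbacktracking cycles)] -/
theorem isCyclicallyReduced_rotate {ρ : Word d} (h : FreeGroup.IsCyclicallyReduced ρ) (k : ℕ) :
    FreeGroup.IsCyclicallyReduced (ρ.rotate k) := by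
  rw [isCyclicallyReduced_iff_isReduced_append_self]
  have h3 : FreeGroup.IsReduced (ρ ++ ρ ++ ρ) := by
    have := (h.flatten_replicate 3).isReduced
    simpa [List.replicate, List.flatten] using this
  exact h3.infix (rotate_append_rotate_infix ρ k)

/-- **Loops are cycles**: every rotation of a loop is a loop. [cite: Chatterjee2019LargeN, §2.1 (loops = nonbacktracking cycles)] -/
theorem IsLoop.rotate {ρ : Word d} (h : IsLoop ρ) (k : ℕ) : IsLoop (ρ.rotate k) :=
  ⟨h.1.rotate k, isCyclicallyReduced_rotate h.2 k⟩

/-- The core of any rotation of a closed path is a loop (the cycle's core, up to the representative; cf. Lemma 2.1).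
[cite: Chatterjee2019LargeN, §2.1 (Lemma 2.1, nonbacktracking core of a cycle)] -/
theorem isLoop_core_rotate {ρ : Word d} (h : IsClosedPath ρ) (k : ℕ) : IsLoop (core (ρ.rotate k)) :=
  isLoop_core (h.rotate k)


/-! ### Paths between given endpoints (§2.1: `u(e)`, `v(e)`), composition and reversal -/

/-- `ρ` is a **path from `A` to `B`**: a path whose first edge begins at `A` and whose last edge ends at `B`
(the null path is a path from `A` to `A`). [cite: Chatterjee2019LargeN, §2.1 (paths; beginning and ending points u(e), v(e))] -/
def IsPathFromTo (ρ : Word d) (A B : Literature.Probability.LatticeModels.Site d) : Prop :=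
  IsPath ρ ∧ (∀ h : ρ ≠ [], DEdge.src (ρ.head h) = A ∧ DEdge.tgt (ρ.getLast h) = B) ∧ (ρ = [] → A = B)

namespace IsPathFromTo

/-- The null path goes from `A` to `B` iff `A = B`. [cite: Chatterjee2019LargeN, §2.1 (null path)] -/
theorem nil_iff {A B : Literature.Probability.LatticeModels.Site d} : IsPathFromTo ([] : Word d) A B ↔ A = B := by
  simp [IsPathFromTo, IsPath]

/-- Peeling the first edge: `e ρ` goes from `A` to `B` iff `u(e) = A` and `ρ` goes from `v(e)` to `B`.
[cite: Chatterjee2019LargeN, §2.1 (definition of a path)] -/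
theorem cons_iff {e : DEdge d} {ρ : Word d} {A B : Literature.Probability.LatticeModels.Site d} :
    IsPathFromTo (e :: ρ) A B ↔ DEdge.src e = A ∧ IsPathFromTo ρ (DEdge.tgt e) B := by
  cases ρ with
  | nil =>
    simp only [IsPathFromTo, IsPath, List.isChain_singleton, ne_eq, List.cons_ne_nil, not_false_eq_true,
      List.head_cons, List.getLast_singleton, IsEmpty.forall_iff, and_true,
      true_and, List.isChain_nil, forall_const]
    tauto
  | cons f ρ =>
    simp only [IsPathFromTo, IsPath, List.isChain_cons_cons, ne_eq, List.cons_ne_nil, not_false_eq_true,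
      List.head_cons, List.getLast_cons_cons, forall_true_left, IsEmpty.forall_iff, and_true]
    constructor
    · rintro ⟨⟨h1, h2⟩, h3, h4⟩; exact ⟨h3, h2, ⟨h1.symm, h4⟩⟩
    · rintro ⟨h3, h2, ⟨h1, h4⟩⟩; exact ⟨⟨h1.symm, h2⟩, h3, h4⟩

/-- Splitting at an edge: `u e v` goes from `A` to `C` iff `u` goes from `A` to `u(e)` and `v` from `v(e)` to `C`.
[cite: Chatterjee2019LargeN, §2.1 (paths)] -/
theorem append_cons_iff {u v : Word d} {e : DEdge d} {A C : Literature.Probability.LatticeModels.Site d} :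
    IsPathFromTo (u ++ e :: v) A C ↔ IsPathFromTo u A (DEdge.src e) ∧ IsPathFromTo v (DEdge.tgt e) C := by
  induction u generalizing A with
  | nil => rw [List.nil_append, cons_iff, nil_iff]; constructor <;> rintro ⟨h1, h2⟩ <;> exact ⟨h1.symm, h2⟩
  | cons f u ih => rw [List.cons_append, cons_iff, cons_iff, ih, and_assoc]

/-- Composition of paths: `A → B` followed by `B → C` is a path `A → C`. [cite: Chatterjee2019LargeN, §2.1 (paths)] -/
theorem append {u v : Word d} {A B C : Literature.Probability.LatticeModels.Site d} (hu : IsPathFromTo u A B)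
    (hv : IsPathFromTo v B C) : IsPathFromTo (u ++ v) A C := by
  induction u generalizing A with
  | nil => rw [nil_iff] at hu; subst hu; simpa using hv
  | cons e u ih => rw [List.cons_append, cons_iff] at *; exact ⟨hu.1, ih hu.2⟩

/-- A single edge is a path from its beginning to its end. [cite: Chatterjee2019LargeN, §2 ¶1 (u(e), v(e))] -/
theorem singleton (e : DEdge d) : IsPathFromTo [e] (DEdge.src e) (DEdge.tgt e) :=
  cons_iff.mpr ⟨rfl, nil_iff.mpr rfl⟩

/-- The inverse path `ρ⁻¹ = eₙ⁻¹ ⋯ e₁⁻¹` goes back from `B` to `A`. [cite: Chatterjee2019LargeN, §2.1 (inverse path)] -/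
theorem invRev {u : Word d} {A B : Literature.Probability.LatticeModels.Site d} (h : IsPathFromTo u A B) :
    IsPathFromTo (FreeGroup.invRev u) B A := by
  induction u generalizing A with
  | nil => rw [nil_iff] at h; rw [FreeGroup.invRev_empty, nil_iff]; exact h.symm
  | cons e u ih =>
    rw [cons_iff] at h
    have h1 : FreeGroup.invRev (e :: u) = FreeGroup.invRev u ++ [DEdge.inv e] := by
      simp [FreeGroup.invRev, DEdge.inv]
    rw [h1]
    refine (ih h.2).append ?_
    have h2 := singleton (DEdge.inv e)
    rwa [DEdge.src_inv, DEdge.tgt_inv, h.1] at h2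

/-- A path from `A` back to `A` is a closed path. [cite: Chatterjee2019LargeN, §2.1 (closed paths)] -/
theorem isClosedPath {u : Word d} {A : Literature.Probability.LatticeModels.Site d} (h : IsPathFromTo u A A) :
    IsClosedPath u :=
  ⟨h.1, fun hne => by obtain ⟨h1, h2⟩ := h.2.1 hne; rw [h2, h1]⟩

end IsPathFromTo

/-- The tail of a closed path `e t` is a path from `v(e)` back to `u(e)`. [cite: Chatterjee2019LargeN, §2.1 (closed paths)] -/
theorem IsClosedPath.isPathFromTo_tail {e : DEdge d} {t : Word d} (h : IsClosedPath (e :: t)) :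
    IsPathFromTo t (DEdge.tgt e) (DEdge.src e) := by
  have h' : IsPathFromTo (e :: t) (DEdge.src e) (DEdge.src e) :=
    ⟨h.1, fun hne => ⟨rfl, h.2 hne⟩, fun h' => absurd h' (List.cons_ne_nil _ _)⟩
  exact (IsPathFromTo.cons_iff.mp h').2

/-- A closed path `e t` is a path from `u(e)` to `u(e)`. [cite: Chatterjee2019LargeN, §2.1 (closed paths)] -/
theorem IsClosedPath.isPathFromTo_cons {e : DEdge d} {t : Word d} (h : IsClosedPath (e :: t)) :
    IsPathFromTo (e :: t) (DEdge.src e) (DEdge.src e) :=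
  IsPathFromTo.cons_iff.mpr ⟨rfl, h.isPathFromTo_tail⟩

/-! ### §2.2: the results of splittings, twistings, mergers and deformations of loops are loops -/

namespace Word

/-- `l` rotated to location `x` reads `e_x · (the rest)`. [cite: Chatterjee2019LargeN, §2.2 (l = e b with a = ∅)] -/
theorem rotate_eq_letter_cons_drop (l : Word d) (x : Fin l.length) :
    l.rotate x = l.letter x :: (l.rotate x).drop 1 := by
  have hn : 0 < (l.rotate (x : ℕ)).length := by
    rw [List.length_rotate]; exact Nat.lt_of_le_of_lt (Nat.zero_le _) x.isLt
  have h := List.cons_getElem_drop_succ (l := l.rotate (x : ℕ)) (n := 0) (h := hn)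
  rw [List.drop_zero] at h
  rw [← h]
  congr 1
  rw [letter, List.get_eq_getElem]
  simp only [List.getElem_rotate, zero_add, Nat.mod_eq_of_lt x.isLt]

/-- For a closed path `l = e_x b e_y c` (read from `x ≠ y`): `b` is a path `v(e_x) → u(e_y)` and `c` a path
`v(e_y) → u(e_x)`. [cite: Chatterjee2019LargeN, §2.2 (l = a e b e' c)] -/
theorem arcs_isPathFromTo {l : Word d} (hl : IsClosedPath l) {x y : Fin l.length} (hxy : x ≠ y) :
    IsPathFromTo (arcBetween l x y) (DEdge.tgt (l.letter x)) (DEdge.src (l.letter y)) ∧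
      IsPathFromTo (arcAfter l x y) (DEdge.tgt (l.letter y)) (DEdge.src (l.letter x)) := by
  have h := hl.rotate x
  rw [rotate_eq_letter_cons hxy] at h
  exact IsPathFromTo.append_cons_iff.mp h.isPathFromTo_tail

/-- `×¹_{x,y} l` is a loop (positive splitting: the same edge `e` at `x ≠ y`; «`l₁` and `l₂` are non-null loops» is
Lemma 9.3; here only loop-ness). [cite: Chatterjee2019LargeN, §2.2 (positive splitting), Lemma 9.3] -/
theorem isLoop_posSplit₁ {l : Word d} (hl : IsClosedPath l) {x y : Fin l.length} (hxy : x ≠ y)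
    (he : l.get y = l.get x) : IsLoop (posSplit₁ l x y) := by
  obtain ⟨-, hc⟩ := arcs_isPathFromTo hl hxy
  have he' : l.letter y = l.letter x := he
  rw [he'] at hc
  refine isLoop_core (IsPathFromTo.isClosedPath (A := DEdge.src (l.letter x)) ?_)
  rw [IsPathFromTo.cons_iff]
  exact ⟨rfl, hc⟩

/-- `×²_{x,y} l` is a loop (positive splitting). [cite: Chatterjee2019LargeN, §2.2 (positive splitting), Lemma 9.3] -/
theorem isLoop_posSplit₂ {l : Word d} (hl : IsClosedPath l) {x y : Fin l.length} (hxy : x ≠ y)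
    (he : l.get y = l.get x) : IsLoop (posSplit₂ l x y) := by
  obtain ⟨hb, -⟩ := arcs_isPathFromTo hl hxy
  have he' : l.letter y = l.letter x := he
  rw [he'] at hb
  refine isLoop_core (IsPathFromTo.isClosedPath (A := DEdge.tgt (l.letter x)) ?_)
  rw [IsPathFromTo.append_cons_iff]
  exact ⟨hb, IsPathFromTo.nil_iff.mpr rfl⟩

/-- `×¹_{x,y} l` is a loop (negative splitting: `e` at `x`, `e⁻¹` at `y`). [cite: Chatterjee2019LargeN, §2.2 (negative splitting), Lemma 9.5] -/
theorem isLoop_negSplit₁ {l : Word d} (hl : IsClosedPath l) {x y : Fin l.length}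
    (he : l.get y = DEdge.inv (l.get x)) : IsLoop (negSplit₁ l x y) := by
  have hxy : x ≠ y := by
    rintro rfl
    have h2 := congrArg Prod.snd he
    simp only [DEdge.inv] at h2
    revert h2; cases (l.get x).2 <;> decide
  obtain ⟨-, hc⟩ := arcs_isPathFromTo hl hxy
  refine isLoop_core (IsPathFromTo.isClosedPath (A := DEdge.src (l.letter x)) ?_)
  have h1 : DEdge.tgt (l.letter y) = DEdge.src (l.letter x) := by rw [letter, letter, he, DEdge.tgt_inv]
  rwa [h1] at hc

/-- `×²_{x,y} l` is a loop (negative splitting). [cite: Chatterjee2019LargeN, §2.2 (negative splitting), Lemma 9.5] -/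
theorem isLoop_negSplit₂ {l : Word d} (hl : IsClosedPath l) {x y : Fin l.length}
    (he : l.get y = DEdge.inv (l.get x)) : IsLoop (negSplit₂ l x y) := by
  have hxy : x ≠ y := by
    rintro rfl
    have h2 := congrArg Prod.snd he
    simp only [DEdge.inv] at h2
    revert h2; cases (l.get x).2 <;> decide
  obtain ⟨hb, -⟩ := arcs_isPathFromTo hl hxy
  refine isLoop_core (IsPathFromTo.isClosedPath (A := DEdge.tgt (l.letter x)) ?_)
  have h1 : DEdge.src (l.letter y) = DEdge.tgt (l.letter x) := by rw [letter, letter, he, DEdge.src_inv]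
  rwa [h1] at hb

/-- The negative twisting `[b⁻¹ c]` of a closed path (same edge at `x ≠ y`) is a loop.
[cite: Chatterjee2019LargeN, §2.2 (negative twisting)] -/
theorem isLoop_negTwist {l : Word d} (hl : IsClosedPath l) {x y : Fin l.length} (hxy : x ≠ y)
    (he : l.get y = l.get x) : IsLoop (negTwist l x y) := by
  obtain ⟨hb, hc⟩ := arcs_isPathFromTo hl hxy
  have he' : l.letter y = l.letter x := he
  rw [he'] at hb hc
  exact isLoop_core (IsPathFromTo.isClosedPath (hb.invRev.append hc))

/-- The positive twisting `[e b⁻¹ e⁻¹ c]` of a closed path (`e` at `x`, `e⁻¹` at `y`) is a loop.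
[cite: Chatterjee2019LargeN, §2.2 (positive twisting)] -/
theorem isLoop_posTwist {l : Word d} (hl : IsClosedPath l) {x y : Fin l.length}
    (he : l.get y = DEdge.inv (l.get x)) : IsLoop (posTwist l x y) := by
  have hxy : x ≠ y := by
    rintro rfl
    have h2 := congrArg Prod.snd he
    simp only [DEdge.inv] at h2
    revert h2; cases (l.get x).2 <;> decide
  obtain ⟨hb, hc⟩ := arcs_isPathFromTo hl hxy
  have h1 : DEdge.src (l.letter y) = DEdge.tgt (l.letter x) := by rw [letter, letter, he, DEdge.src_inv]
  have h2 : DEdge.tgt (l.letter y) = DEdge.src (l.letter x) := by rw [letter, letter, he, DEdge.tgt_inv]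
  refine isLoop_core (IsPathFromTo.isClosedPath (A := DEdge.src (l.letter x)) ?_)
  rw [List.cons_append, IsPathFromTo.cons_iff]
  refine ⟨rfl, ?_⟩
  rw [IsPathFromTo.append_cons_iff, DEdge.src_inv, DEdge.tgt_inv]
  refine ⟨?_, by rwa [h2] at hc⟩
  have := hb.invRev; rwa [h1] at this

/-- Mergers, positive case: if `e t` and `a d` are closed paths with `a ∈ {e, e⁻¹}`, the positive merger word
(`[e d e t]`, resp. `[e d⁻¹ e t]`) is a loop. [cite: Chatterjee2019LargeN, §2.2 (positive merger, both cases)] -/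
theorem isLoop_posMergeRot {e a : DEdge d} {t d' : Word d} (hW : IsClosedPath (e :: t)) (hP : IsClosedPath (a :: d'))
    (ha : a.1 = e.1) : IsLoop (posMergeRot (e :: t) (a :: d')) := by
  have ht := hW.isPathFromTo_tail
  have hd := hP.isPathFromTo_tail
  rw [posMergeRot]
  split_ifs with h2
  · have hae : a = e := Prod.ext ha h2
    subst hae
    refine isLoop_core (IsPathFromTo.isClosedPath (A := DEdge.src a) ?_)
    rw [List.cons_append, IsPathFromTo.cons_iff]
    exact ⟨rfl, hd.append hW.isPathFromTo_cons⟩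
  · have hae : a = DEdge.inv e := by
      refine Prod.ext ha ?_
      simp only [DEdge.inv]
      revert h2; cases a.2 <;> cases e.2 <;> decide
    subst hae
    rw [DEdge.src_inv, DEdge.tgt_inv] at hd
    refine isLoop_core (IsPathFromTo.isClosedPath (A := DEdge.src e) ?_)
    rw [List.cons_append, IsPathFromTo.cons_iff]
    exact ⟨rfl, hd.invRev.append hW.isPathFromTo_cons⟩

/-- Mergers, negative case: with `e t`, `a d` as above the negative merger word (`[d⁻¹ t]`, resp. `[d t]`) is a loop.
[cite: Chatterjee2019LargeN, §2.2 (negative merger, both cases)] -/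
theorem isLoop_negMergeRot {e a : DEdge d} {t d' : Word d} (hW : IsClosedPath (e :: t)) (hP : IsClosedPath (a :: d'))
    (ha : a.1 = e.1) : IsLoop (negMergeRot (e :: t) (a :: d')) := by
  have ht := hW.isPathFromTo_tail
  have hd := hP.isPathFromTo_tail
  rw [negMergeRot]
  split_ifs with h2
  · have hae : a = e := Prod.ext ha h2
    subst hae
    exact isLoop_core (IsPathFromTo.isClosedPath (hd.invRev.append ht))
  · have hae : a = DEdge.inv e := by
      refine Prod.ext ha ?_
      simp only [DEdge.inv]
      revert h2; cases a.2 <;> cases e.2 <;> decide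
    subst hae
    rw [DEdge.src_inv, DEdge.tgt_inv] at hd
    exact isLoop_core (IsPathFromTo.isClosedPath (hd.append ht))

/-- `l ⊕_{x,y} l'` is a loop (the two locations carry the same undirected edge). [cite: Chatterjee2019LargeN, §2.2 (positive merger)] -/
theorem isLoop_posMerge {l m : Word d} (hl : IsClosedPath l) (hm : IsClosedPath m) {x : Fin l.length} {y : Fin m.length}
    (h : (m.get y).1 = (l.get x).1) : IsLoop (posMerge l x m y) := by
  rw [posMerge, rotate_eq_letter_cons_drop l x, rotate_eq_letter_cons_drop m y]
  exact isLoop_posMergeRot (by rw [← rotate_eq_letter_cons_drop]; exact hl.rotate x)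
    (by rw [← rotate_eq_letter_cons_drop]; exact hm.rotate y) h

/-- `l ⊖_{x,y} l'` is a loop. [cite: Chatterjee2019LargeN, §2.2 (negative merger)] -/
theorem isLoop_negMerge {l m : Word d} (hl : IsClosedPath l) (hm : IsClosedPath m) {x : Fin l.length} {y : Fin m.length}
    (h : (m.get y).1 = (l.get x).1) : IsLoop (negMerge l x m y) := by
  rw [negMerge, rotate_eq_letter_cons_drop l x, rotate_eq_letter_cons_drop m y]
  exact isLoop_negMergeRot (by rw [← rotate_eq_letter_cons_drop]; exact hl.rotate x)
    (by rw [← rotate_eq_letter_cons_drop]; exact hm.rotate y) h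

/-- `l ⊕ₓ p` is a loop for `p ∈ 𝒫⁺(e_x)`. [cite: Chatterjee2019LargeN, §2.2 (deformation l ⊕ₓ p)] -/
theorem isLoop_posDeform {l : Word d} (hl : IsClosedPath l) (x : Fin l.length) {p : ZdPlaquette d}
    (hp : p ∈ plaquettesAt (l.get x)) : IsLoop (posDeform l x p) := by
  obtain ⟨a, d', hrot, ha⟩ := rotate_plaquetteLoc_eq_cons hp
  have hP : IsClosedPath (a :: d') := by rw [← hrot]; exact (isLoop_plaquetteWord p).1.rotate _
  rw [posDeform, letter, hrot, rotate_eq_letter_cons_drop l x]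
  exact isLoop_posMergeRot (by rw [← rotate_eq_letter_cons_drop]; exact hl.rotate x) hP ha

/-- `l ⊖ₓ p` is a loop for `p ∈ 𝒫⁺(e_x)`. [cite: Chatterjee2019LargeN, §2.2 (deformation l ⊖ₓ p)] -/
theorem isLoop_negDeform {l : Word d} (hl : IsClosedPath l) (x : Fin l.length) {p : ZdPlaquette d}
    (hp : p ∈ plaquettesAt (l.get x)) : IsLoop (negDeform l x p) := by
  obtain ⟨a, d', hrot, ha⟩ := rotate_plaquetteLoc_eq_cons hp
  have hP : IsClosedPath (a :: d') := by rw [← hrot]; exact (isLoop_plaquetteWord p).1.rotate _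
  rw [negDeform, letter, hrot, rotate_eq_letter_cons_drop l x]
  exact isLoop_negMergeRot (by rw [← rotate_eq_letter_cons_drop]; exact hl.rotate x) hP ha

end Word

/-! ### §2.2: the operations map genuine loop sequences to genuine loop sequences -/

namespace LoopSeq

/-- A pruned list of loops is a genuine loop sequence. [cite: Chatterjee2019LargeN, §2.2 (minimal representation: null loops deleted)] -/
theorem isLoopSeq_prune {L : LoopSeq d} (h : ∀ l ∈ L, IsLoop l) : IsLoopSeq (prune L) := by
  intro l hl
  rw [prune, List.mem_filter] at hl
  exact ⟨h l hl.1, by simpa using hl.2⟩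

end LoopSeq

/-- Replacing a component of a genuine loop sequence by loops (and pruning) gives a genuine loop sequence.
[cite: Chatterjee2019LargeN, §2.2 (operations on loop sequences)] -/
theorem IsLoopSeq.replaceAt {s : LoopSeq d} (hs : IsLoopSeq s) (i : ℕ) {ws : List (Word d)}
    (hws : ∀ w ∈ ws, IsLoop w) : IsLoopSeq (s.replaceAt i ws) := by
  rw [LoopSeq.replaceAt]
  refine LoopSeq.isLoopSeq_prune fun l hl => ?_
  simp only [List.mem_append] at hl
  rcases hl with (hl | hl) | hl
  · exact (hs l (List.mem_of_mem_take hl)).1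
  · exact hws l hl
  · exact (hs l (List.mem_of_mem_drop hl)).1

/-- A positive splitting of a genuine loop sequence is a genuine loop sequence. [cite: Chatterjee2019LargeN, §2.2 (𝕊⁺(s))] -/
theorem IsLoopSeq.posSplitAt {s : LoopSeq d} (hs : IsLoopSeq s) (o : SameIdx s) : IsLoopSeq (s.posSplitAt o) := by
  obtain ⟨i, ⟨⟨x, y⟩, hxy, he⟩⟩ := o
  have hl := (hs _ (List.get_mem s i)).1.1
  refine hs.replaceAt _ fun w hw => ?_
  simp only [List.mem_cons, List.not_mem_nil, or_false] at hw
  rcases hw with rfl | rfl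
  · exact Word.isLoop_posSplit₁ hl hxy he
  · exact Word.isLoop_posSplit₂ hl hxy he

/-- A negative splitting of a genuine loop sequence is a genuine loop sequence. [cite: Chatterjee2019LargeN, §2.2 (𝕊⁻(s))] -/
theorem IsLoopSeq.negSplitAt {s : LoopSeq d} (hs : IsLoopSeq s) (o : InvIdx s) : IsLoopSeq (s.negSplitAt o) := by
  obtain ⟨i, ⟨⟨x, y⟩, he⟩⟩ := o
  have hl := (hs _ (List.get_mem s i)).1.1
  refine hs.replaceAt _ fun w hw => ?_
  simp only [List.mem_cons, List.not_mem_nil, or_false] at hw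
  rcases hw with rfl | rfl
  · exact Word.isLoop_negSplit₁ hl he
  · exact Word.isLoop_negSplit₂ hl he

/-- A negative twisting of a genuine loop sequence is a genuine loop sequence. [cite: Chatterjee2019LargeN, §2.2 (𝕋⁻(s))] -/
theorem IsLoopSeq.negTwistAt {s : LoopSeq d} (hs : IsLoopSeq s) (o : SameIdx s) : IsLoopSeq (s.negTwistAt o) := by
  obtain ⟨i, ⟨⟨x, y⟩, hxy, he⟩⟩ := o
  have hl := (hs _ (List.get_mem s i)).1.1
  refine hs.replaceAt _ fun w hw => ?_
  simp only [List.mem_cons, List.not_mem_nil, or_false] at hw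
  subst hw
  exact Word.isLoop_negTwist hl hxy he

/-- A positive twisting of a genuine loop sequence is a genuine loop sequence. [cite: Chatterjee2019LargeN, §2.2 (𝕋⁺(s))] -/
theorem IsLoopSeq.posTwistAt {s : LoopSeq d} (hs : IsLoopSeq s) (o : InvIdx s) : IsLoopSeq (s.posTwistAt o) := by
  obtain ⟨i, ⟨⟨x, y⟩, he⟩⟩ := o
  have hl := (hs _ (List.get_mem s i)).1.1
  refine hs.replaceAt _ fun w hw => ?_
  simp only [List.mem_cons, List.not_mem_nil, or_false] at hw
  subst hw
  exact Word.isLoop_posTwist hl he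

/-- A positive deformation of a genuine loop sequence is a genuine loop sequence. [cite: Chatterjee2019LargeN, §2.2 (𝔻⁺(s))] -/
theorem IsLoopSeq.posDeformAt {s : LoopSeq d} (hs : IsLoopSeq s) (o : DeformIdx s) : IsLoopSeq (s.posDeformAt o) := by
  obtain ⟨i, x, ⟨p, hp⟩⟩ := o
  have hl := (hs _ (List.get_mem s i)).1.1
  refine hs.replaceAt _ fun w hw => ?_
  simp only [List.mem_cons, List.not_mem_nil, or_false] at hw
  subst hw
  exact Word.isLoop_posDeform hl x hp

/-- A negative deformation of a genuine loop sequence is a genuine loop sequence. [cite: Chatterjee2019LargeN, §2.2 (𝔻⁻(s))] -/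
theorem IsLoopSeq.negDeformAt {s : LoopSeq d} (hs : IsLoopSeq s) (o : DeformIdx s) : IsLoopSeq (s.negDeformAt o) := by
  obtain ⟨i, x, ⟨p, hp⟩⟩ := o
  have hl := (hs _ (List.get_mem s i)).1.1
  refine hs.replaceAt _ fun w hw => ?_
  simp only [List.mem_cons, List.not_mem_nil, or_false] at hw
  subst hw
  exact Word.isLoop_negDeform hl x hp

/-- A positive merger of a genuine loop sequence is a genuine loop sequence. [cite: Chatterjee2019LargeN, §2.2 (𝕄⁺(s))] -/
theorem IsLoopSeq.posMergeAt {s : LoopSeq d} (hs : IsLoopSeq s) (o : MergeIdx s) : IsLoopSeq (s.posMergeAt o) := by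
  obtain ⟨i, j, ⟨⟨x, y⟩, hij, he⟩⟩ := o
  rw [LoopSeq.posMergeAt]
  refine LoopSeq.isLoopSeq_prune fun l hl => ?_
  rcases List.mem_or_eq_of_mem_set (List.mem_of_mem_eraseIdx hl) with h | h
  · exact (hs l h).1
  · subst h
    exact Word.isLoop_posMerge (hs _ (List.get_mem s i)).1.1 (hs _ (List.get_mem s j)).1.1 he

/-- A negative merger of a genuine loop sequence is a genuine loop sequence. [cite: Chatterjee2019LargeN, §2.2 (𝕄⁻(s))] -/
theorem IsLoopSeq.negMergeAt {s : LoopSeq d} (hs : IsLoopSeq s) (o : MergeIdx s) : IsLoopSeq (s.negMergeAt o) := by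
  obtain ⟨i, j, ⟨⟨x, y⟩, hij, he⟩⟩ := o
  rw [LoopSeq.negMergeAt]
  refine LoopSeq.isLoopSeq_prune fun l hl => ?_
  rcases List.mem_or_eq_of_mem_set (List.mem_of_mem_eraseIdx hl) with h | h
  · exact (hs l h).1
  · subst h
    exact Word.isLoop_negMerge (hs _ (List.get_mem s i)).1.1 (hs _ (List.get_mem s j)).1.1 he

/-- **Every move of a trajectory maps genuine loop sequences to genuine loop sequences.**
[cite: Chatterjee2019LargeN, §2.2 (trajectories: deformations and splittings)] -/
theorem IsLoopSeq.moveResult {s : LoopSeq d} (hs : IsLoopSeq s) : ∀ m : Move s, IsLoopSeq m.result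
  | Move.posDeform o => hs.posDeformAt o
  | Move.negDeform o => hs.negDeformAt o
  | Move.posSplit o => hs.posSplitAt o
  | Move.negSplit o => hs.negSplitAt o

/-! ### Lemmas 9.3 / 9.5 (v1.1): the two pieces of a splitting of a loop are NON-NULL; Lemma 11.3: `𝒳₀(s) = ∅`, `a₀(s) = 0`

Lemma 9.3: «`l₁` and `l₂` are non-null loops» (positive splitting), Lemma 9.5: «`l₁` and `l₂` are non-null loops or null loops
… » — in print the negative pieces `[ac]`, `[b]` of `l = a e b e⁻¹ c` are non-null because `e, e⁻¹` cannot be adjacent in a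
loop and a nonempty piece of a loop has a non-null nonbacktracking core; Lemma 11.3: «By Lemmas 9.3 and 9.5, splittings
of non-null loops can never give rise to null loops. Therefore a vanishing trajectory must contain at least one deformation
step, proving that `𝒳₀(s)` is empty for any non-null `s`», whence `a₀(s) = 0` («`a₀(s) = 0` for every non-null `s`», §10). -/

namespace Word

/-- A nonempty reduced word has a non-null cyclic reduction: `ρ = c [ρ] c⁻¹` with `[ρ] = ∅` would make `ρ = c c⁻¹`
backtrack at the junction. [cite: Chatterjee2019LargeN, §2.1 (nonbacktracking core; Lemma 2.1)] -/
theorem reduceCyclically_ne_nil {ρ : Word d} (h : FreeGroup.IsReduced ρ) (hne : ρ ≠ []) :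
    FreeGroup.reduceCyclically ρ ≠ [] := by
  intro h0
  have hc := FreeGroup.reduceCyclically.conj_conjugator_reduceCyclically ρ
  rw [h0, List.append_nil] at hc
  rcases List.eq_nil_or_concat (FreeGroup.reduceCyclically.conjugator ρ) with hc0 | ⟨c', a, hc'⟩
  · apply hne
    rw [← hc, hc0]
    rfl
  · rw [List.concat_eq_append] at hc'
    have hinv : FreeGroup.invRev (FreeGroup.reduceCyclically.conjugator ρ) = (a.1, !a.2) :: FreeGroup.invRev c' := by
      rw [hc']
      simp [FreeGroup.invRev]
    rw [hinv, hc', List.append_assoc, List.singleton_append] at hc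
    have hinf : [a, (a.1, !a.2)] <:+: ρ := ⟨c', FreeGroup.invRev c', by rw [← hc]; simp⟩
    have h2 := (h.infix hinf)
    rw [FreeGroup.isReduced_cons_cons] at h2
    have h3 := h2.1 rfl
    revert h3
    cases a.2 <;> simp

/-- Hence the nonbacktracking core of a nonempty reduced word is non-null. [cite: Chatterjee2019LargeN, §2.1 (nonbacktracking core)] -/
theorem core_ne_nil {ρ : Word d} (h : FreeGroup.IsReduced ρ) (hne : ρ ≠ []) : core ρ ≠ [] := by
  rw [core, h.reduce_eq]
  exact reduceCyclically_ne_nil h hne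

/-- In the inverse-letter case the two locations are distinct. [cite: Chatterjee2019LargeN, §2.2 (negative splitting at x ≠ y)] -/
theorem ne_of_get_eq_inv {l : Word d} {x y : Fin l.length} (he : l.get y = DEdge.inv (l.get x)) : x ≠ y := by
  rintro rfl
  have h2 := congrArg Prod.snd he
  simp only [DEdge.inv] at h2
  revert h2; cases (l.get x).2 <;> decide

/-- **Lemma 9.3, non-nullness of `×¹_{x,y} l`** (same edge at `x ≠ y`): the word `e c` is a piece of the loop read from `y`,
hence reduced and nonempty, so its core is non-null. [cite: Chatterjee2019LargeN, Lemma 9.3 («l₁ and l₂ are non-null loops»)] -/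
theorem posSplit₁_ne_nil {l : Word d} (hl : IsLoop l) {x y : Fin l.length} (hxy : x ≠ y) (he : l.get y = l.get x) :
    posSplit₁ l x y ≠ [] := by
  rw [posSplit₁]
  refine core_ne_nil ?_ (List.cons_ne_nil _ _)
  have hr : FreeGroup.IsReduced (l.rotate x) := (hl.rotate x).2.isReduced
  rw [rotate_eq_letter_cons hxy] at hr
  have he' : l.letter y = l.letter x := he
  refine hr.infix ⟨l.letter x :: arcBetween l x y, [], ?_⟩
  rw [← he']
  simp

/-- **Lemma 9.3, non-nullness of `×²_{x,y} l`**: the word `b e` is a piece of the loop. [cite: Chatterjee2019LargeN, Lemma 9.3 («l₁ and l₂ are non-null loops»)] -/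
theorem posSplit₂_ne_nil {l : Word d} (hl : IsLoop l) {x y : Fin l.length} (hxy : x ≠ y) (he : l.get y = l.get x) :
    posSplit₂ l x y ≠ [] := by
  rw [posSplit₂]
  refine core_ne_nil ?_ (by simp)
  have hr : FreeGroup.IsReduced (l.rotate x) := (hl.rotate x).2.isReduced
  rw [rotate_eq_letter_cons hxy] at hr
  have he' : l.letter y = l.letter x := he
  refine hr.infix ⟨[l.letter x], arcAfter l x y, ?_⟩
  rw [← he']
  simp

/-- **Lemma 9.5, non-nullness of `×¹_{x,y} l`** (`e` at `x`, `e⁻¹` at `y`): the piece `c a` after `e⁻¹` is nonempty — else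
`e⁻¹` would be the last and `e` the first letter of the loop read from `x`, a terminal backtrack — and reduced.
[cite: Chatterjee2019LargeN, Lemma 9.5 (the pieces [ac], [b] of l = aebe⁻¹c), §2.1 (no terminal backtrack)] -/
theorem negSplit₁_ne_nil {l : Word d} (hl : IsLoop l) {x y : Fin l.length} (he : l.get y = DEdge.inv (l.get x)) :
    negSplit₁ l x y ≠ [] := by
  have hxy := ne_of_get_eq_inv he
  have hrl := hl.rotate x
  rw [rotate_eq_letter_cons hxy] at hrl
  have he' : l.letter y = DEdge.inv (l.letter x) := he
  rw [negSplit₁]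
  refine core_ne_nil (hrl.2.isReduced.infix ⟨l.letter x :: (arcBetween l x y ++ [l.letter y]), [], by simp⟩) ?_
  intro h0
  rw [h0, he'] at hrl
  have h := hrl.2.2 (DEdge.inv (l.letter x)) (by
      rw [show l.letter x :: (arcBetween l x y ++ [DEdge.inv (l.letter x)])
        = (l.letter x :: arcBetween l x y) ++ [DEdge.inv (l.letter x)] from rfl, List.getLast?_concat]; rfl)
    (l.letter x) rfl rfl
  simp only [DEdge.inv] at h
  revert h; cases (l.letter x).2 <;> decide

/-- **Lemma 9.5, non-nullness of `×²_{x,y} l`**: the piece `b` between `e` and `e⁻¹` is nonempty — else `e e⁻¹` would be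
an interior backtrack — and reduced. [cite: Chatterjee2019LargeN, Lemma 9.5, §2.1 (no interior backtrack)] -/
theorem negSplit₂_ne_nil {l : Word d} (hl : IsLoop l) {x y : Fin l.length} (he : l.get y = DEdge.inv (l.get x)) :
    negSplit₂ l x y ≠ [] := by
  have hxy := ne_of_get_eq_inv he
  have hr : FreeGroup.IsReduced (l.rotate x) := (hl.rotate x).2.isReduced
  rw [rotate_eq_letter_cons hxy] at hr
  have he' : l.letter y = DEdge.inv (l.letter x) := he
  rw [negSplit₂]
  refine core_ne_nil (hr.infix ⟨[l.letter x], l.letter y :: arcAfter l x y, by simp⟩) ?_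
  intro h0
  rw [h0, List.nil_append, he', FreeGroup.isReduced_cons_cons] at hr
  have h := hr.1 rfl
  simp only [DEdge.inv] at h
  revert h; cases (l.letter x).2 <;> decide

end Word

namespace LoopSeq

/-- A replacement by a list containing a non-null word is a non-null loop sequence. [cite: Chatterjee2019LargeN, §2.2 (s' after a splitting)] -/
theorem replaceAt_ne_nil_of_mem {s : LoopSeq d} {i : ℕ} {ws : List (Word d)} {w : Word d} (hw : w ∈ ws) (hne : w ≠ []) :
    s.replaceAt i ws ≠ [] := by
  intro h0
  have hmem : w ∈ s.replaceAt i ws := by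
    rw [replaceAt, prune, List.mem_filter]
    exact ⟨List.mem_append_left _ (List.mem_append_right _ hw), by simpa using hne⟩
  rw [h0] at hmem
  exact List.not_mem_nil hmem

/-- A positive splitting of a genuine loop sequence is non-null (Lemma 9.3: `#s' = #s + 1`). [cite: Chatterjee2019LargeN, Lemma 9.3] -/
theorem posSplitAt_ne_nil {s : LoopSeq d} (hs : IsLoopSeq s) (o : SameIdx s) : s.posSplitAt o ≠ [] :=
  replaceAt_ne_nil_of_mem (List.mem_cons_self)
    (Word.posSplit₁_ne_nil (hs _ (List.get_mem s o.1)).1 o.2.2.1 o.2.2.2)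

/-- A negative splitting of a genuine loop sequence is non-null (Lemma 9.5). [cite: Chatterjee2019LargeN, Lemma 9.5] -/
theorem negSplitAt_ne_nil {s : LoopSeq d} (hs : IsLoopSeq s) (o : InvIdx s) : s.negSplitAt o ≠ [] :=
  replaceAt_ne_nil_of_mem (List.mem_cons_self) (Word.negSplit₁_ne_nil (hs _ (List.get_mem s o.1)).1 o.2.2)

end LoopSeq

/-- **Lemma 11.3 (second part), PROVED**: «a vanishing trajectory [from a non-null loop sequence] must contain at least one
deformation step» — splittings of genuine loop sequences never produce the null sequence.
[cite: Chatterjee2019LargeN, Lemma 11.3 («𝒳₀(s) is empty»)] -/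
theorem Trajectory.numDeform_pos : ∀ {s : LoopSeq d} (_ : IsLoopSeq s) (_ : s ≠ []) (X : Trajectory s), 0 < X.numDeform
  | _, _, hne, Trajectory.nil => absurd rfl hne
  | _, hs, _, Trajectory.cons (Move.posDeform o) X => by simp [Trajectory.numDeform, Move.isDeform]
  | _, hs, _, Trajectory.cons (Move.negDeform o) X => by simp [Trajectory.numDeform, Move.isDeform]
  | _, hs, _, Trajectory.cons (Move.posSplit o) X => by
    have ih := Trajectory.numDeform_pos (hs.posSplitAt o) (LoopSeq.posSplitAt_ne_nil hs o) X
    simp only [Trajectory.numDeform, Move.isDeform, Bool.false_eq_true, if_false, zero_add]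
    exact ih
  | _, hs, _, Trajectory.cons (Move.negSplit o) X => by
    have ih := Trajectory.numDeform_pos (hs.negSplitAt o) (LoopSeq.negSplitAt_ne_nil hs o) X
    simp only [Trajectory.numDeform, Move.isDeform, Bool.false_eq_true, if_false, zero_add]
    exact ih

/-- `𝒳₀(s)` is empty for a genuine non-null loop sequence. [cite: Chatterjee2019LargeN, Lemma 11.3 («𝒳₀(s) is empty»)] -/
theorem isEmpty_trajectoryWith_zero {s : LoopSeq d} (hs : IsLoopSeq s) (hne : s ≠ []) : IsEmpty (TrajectoryWith s 0) :=
  ⟨fun X => (Trajectory.numDeform_pos hs hne X.1).ne' X.2⟩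

/-- ★ **`a₀(s) = 0` for every genuine non-null loop sequence, PROVED** («`a₀(s) = 0` for every non-null `s`», §10; for the
trajectory sums of Corollary 3.5 this is Lemma 11.3) — the first conjunct of the named fact `CoeffRecursion`.
[cite: Chatterjee2019LargeN, §10 (a₀(s) = 0 for non-null s), Lemma 11.3, Corollary 3.5] -/
theorem coeffA_zero_of_ne_nil {s : LoopSeq d} (hs : IsLoopSeq s) (hne : s ≠ []) : coeffA s 0 = 0 := by
  haveI := isEmpty_trajectoryWith_zero hs hne
  exact tsum_empty

end Literature.MathematicalPhysics.QuantumFieldTheory.Chatterjee2019LargeN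

end
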